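import Literature.NumberTheory.Sieve.SelbergSieveCouplingBound
import Literature.NumberTheory.Sieve.SelbergSieveGBoxExt
import HarnessLib

/-!
# Maynard's Proposition 9.4: the bound for the dual variables `y⁺` of the product weights

Source: J. Maynard, *Dense clusters of primes in subsets*, Compositio Math. 152 (2016) =
arXiv:1405.2593 [Maynard2016DenseClusters], proof of Proposition 9.4 pp. 25–26 (P94-SPEC §1d′).

With `λ⁺ = λ · λ̃` the product weights on the `(k+1)`-dimensional box (`SelbergSieveOptionBox`) and
`y⁺ = dualY λ⁺`, `SelbergSieveOptionBox.dualY_lamProd_eq` gives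
`y⁺(r⁺) = μ(∏ r⁺) ∑_{g ⊇ r} ∑_{g₀ ⊇ r₀} Y_g φ(g₀)^{-1} B(r⁺; g, g₀)`.
Here we bound `|y⁺(r⁺)|` assuming `|Y_g| ≤ A ∏_{p ∈ primes(∏g)∖primes(∏r)} a(p)` for the multiples
`g` of `r` (for Maynard's `Y_g = y_g/φ_ω(g)` one has `a(p) = 1/(p - k)`, `A = y_r/φ_ω(r)` by the
antitonicity of `F`): **`abs_dualY_lamProd_le`**
`|y⁺(r⁺)| ≤ A φ(r₀)^{-1} ∏_{p ∣ ∏ r}(1 + 2/(p-1)) ∏_{p ≤ T, p ∤ ∏ r}(1 + |κ|·2a(p)·c(p))`,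
`c(p) = 1` if `p ∣ r₀` and `2/(p-1)` otherwise — the fresh primes of `g` must divide `g₀`
(`SelbergSieveCouplingBound`), which is what makes the last product convergent.
Ingredients: `sum_g0_le` (the `g₀`-sum for fixed `g`, via `sum_squarefree_ext_prod_le` with mandatory
part `r₀ · ∏(fresh primes of g outside r₀)`), then `sum_ext_prod_le` for the `g`-sum.

## References
* J. Maynard, *Dense clusters of primes in subsets*, Compositio Math. 152 (2016), proof of Prop. 9.4
  pp. 25–26 [Maynard2016DenseClusters].
-/

noncomputable section

open Finset
open scoped ArithmeticFunction.Moebius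

namespace Literature.NumberTheory.Sieve.SelbergBox

variable {κ : Type*} [Fintype κ] [DecidableEq κ]

/-! ### Arithmetic helpers -/

omit [Fintype κ] [DecidableEq κ] in
/-- `φ(n) = ∏_{p ∣ n} (p - 1)` for square-free `n`, cast to `ℝ` (real form of the `ℕ`-identity
`totient_eq_prod_sub_one_of_squarefree` of `RomanovTheorem`, not imported here to keep the closure small).
[cite: Maynard2016DenseClusters, proof of Lemma 8.4 p. 17 (multiplicativity of φ on square-free r)] -/
theorem totient_eq_prod_sub_one {n : ℕ} (hn : Squarefree n) :
    ((Nat.totient n : ℕ) : ℝ) = ∏ p ∈ n.primeFactors, ((p : ℝ) - 1) := by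
  have h := Nat.totient_mul_prod_primeFactors n
  rw [Nat.prod_primeFactors_of_squarefree hn, mul_comm] at h
  have h' : Nat.totient n = ∏ p ∈ n.primeFactors, (p - 1) := Nat.eq_of_mul_eq_mul_left
    (Nat.pos_of_ne_zero hn.ne_zero) h
  rw [h', Nat.cast_prod]
  refine Finset.prod_congr rfl fun p hp => ?_
  rw [Nat.cast_sub (Nat.prime_of_mem_primeFactors hp).one_lt.le, Nat.cast_one]

omit [Fintype κ] [DecidableEq κ] in
/-- For `A ⊆ B ⊆ D`: `∏_{D∖A} = ∏_{B∖A} · ∏_{D∖B}`. [folklore] -/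
private theorem prod_sdiff_split {A B D : Finset ℕ} (hAB : A ⊆ B) (hBD : B ⊆ D) (f : ℕ → ℝ) :
    ∏ p ∈ D \ A, f p = (∏ p ∈ B \ A, f p) * ∏ p ∈ D \ B, f p := by
  have hsub : B \ A ⊆ D \ A := Finset.sdiff_subset_sdiff hBD le_rfl
  rw [← Finset.prod_sdiff hsub, mul_comm]
  congr 1
  refine Finset.prod_congr ?_ fun _ _ => rfl
  ext p
  simp only [Finset.mem_sdiff]
  constructor
  · rintro ⟨⟨hD, hA⟩, h2⟩
    exact ⟨hD, fun hB => h2 ⟨hB, hA⟩⟩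
  · rintro ⟨hD, hB⟩
    exact ⟨⟨hD, fun hA => hB (hAB hA)⟩, fun h => hB h.1⟩

/-! ### The `g₀`-sum for a fixed `g` -/

omit [Fintype κ] [DecidableEq κ] in
/-- **The `g₀`-sum.** For `r₀ ∈ box₀ M R₀` and finite sets of primes `C` (the fresh primes of `g`)
and `S₁` (the primes of `∏ r`):
`∑_{g₀ ∈ box₀, r₀ ∣ g₀, C ⊆ primes(g₀) ⊆ primes(r₀) ∪ C ∪ S₁} φ(g₀)^{-1} 2^{#(primes g₀ ∖ primes r₀)}
  ≤ φ(r₀)^{-1} ∏_{p ∈ C ∖ primes r₀} (2/(p-1)) · ∏_{p ∈ S₁} (1 + 2/(p-1))`.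
[cite: Maynard2016DenseClusters, proof of Prop. 9.4 pp. 25–26] -/
theorem sum_g0_le {M : ℕ} {R₀ : ℝ} {r₀ : ℕ} (hr₀ : r₀ ∈ box₀ M R₀) (C S₁ : Finset ℕ)
    (hC : ∀ p ∈ C, p.Prime) (hS₁ : ∀ p ∈ S₁, p.Prime) :
    ∑ g₀ ∈ (box₀ M R₀).filter (fun g₀ => r₀ ∣ g₀ ∧ C ⊆ g₀.primeFactors ∧
        g₀.primeFactors ⊆ r₀.primeFactors ∪ C ∪ S₁),
      ((Nat.totient g₀ : ℕ) : ℝ)⁻¹ * (2 : ℝ) ^ (g₀.primeFactors \ r₀.primeFactors).card ≤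
    ((Nat.totient r₀ : ℕ) : ℝ)⁻¹ * (∏ p ∈ C \ r₀.primeFactors, 2 / ((p : ℝ) - 1)) *
      ∏ p ∈ S₁, (1 + 2 / ((p : ℝ) - 1)) := by
  classical
  obtain ⟨⟨hr1, -⟩, hr₀sq, -⟩ := mem_box₀.1 hr₀
  have hr0 : r₀ ≠ 0 := by omega
  -- the mandatory part `m = r₀ · ∏_{C ∖ primes r₀} p`
  set C' := C \ r₀.primeFactors with hC'
  set P := ∏ p ∈ C', p with hP
  set m := r₀ * P with hm
  have hC'p : ∀ p ∈ C', p.Prime := fun p hp => hC p (Finset.mem_sdiff.1 hp).1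
  have hP0 : P ≠ 0 := Finset.prod_ne_zero_iff.2 fun p hp => (hC'p p hp).ne_zero
  have hm0 : m ≠ 0 := mul_ne_zero hr0 hP0
  have hpfP : P.primeFactors = C' := Nat.primeFactors_prod hC'p
  have hpfm : m.primeFactors = r₀.primeFactors ∪ C' := by
    rw [hm, Nat.primeFactors_mul hr0 hP0, hpfP]
  have hr₀m : r₀.primeFactors ⊆ m.primeFactors := Nat.primeFactors_mono (Dvd.intro _ rfl) hm0
  have hmsd : m.primeFactors \ r₀.primeFactors = C' := by
    rw [hpfm, Finset.union_sdiff_left, hC']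
    exact sdiff_idem
  set b : ℕ → ℝ := fun p => 2 / ((p : ℝ) - 1) with hb
  have hbnn : ∀ p : ℕ, 0 ≤ (if p.Prime then b p else 0) := by
    intro p
    split_ifs with hp
    · have : (2 : ℝ) ≤ p := by exact_mod_cast hp.two_le
      exact div_nonneg (by norm_num) (by linarith)
    · exact le_rfl
  -- we use the weight `b' p = b p` on primes, `0` elsewhere (so that it is nonnegative everywhere)
  set b' : ℕ → ℝ := fun p => if p.Prime then b p else 0 with hb'
  have hb'eq : ∀ s : Finset ℕ, (∀ p ∈ s, p.Prime) → ∏ p ∈ s, b' p = ∏ p ∈ s, b p := by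
    intro s hs
    exact Finset.prod_congr rfl fun p hp => by rw [hb']; exact if_pos (hs p hp)
  set F := (box₀ M R₀).filter (fun g₀ => r₀ ∣ g₀ ∧ C ⊆ g₀.primeFactors ∧
      g₀.primeFactors ⊆ r₀.primeFactors ∪ C ∪ S₁) with hF
  -- Step 1: rewrite each term
  have hterm : ∀ g₀ ∈ F,
      ((Nat.totient g₀ : ℕ) : ℝ)⁻¹ * (2 : ℝ) ^ (g₀.primeFactors \ r₀.primeFactors).card =
        ((Nat.totient r₀ : ℕ) : ℝ)⁻¹ * ((∏ p ∈ C', b p) *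
          ∏ p ∈ g₀.primeFactors \ m.primeFactors, b' p) := by
    intro g₀ hg₀
    obtain ⟨hg₀b, hrg, hCg, -⟩ := Finset.mem_filter.1 hg₀
    obtain ⟨⟨hg1, -⟩, hg₀sq, -⟩ := mem_box₀.1 hg₀b
    have hg0 : g₀ ≠ 0 := by omega
    have hsub : r₀.primeFactors ⊆ g₀.primeFactors := Nat.primeFactors_mono hrg hg0
    -- m ∣ g₀
    have hPg : P ∣ g₀ := Finset.prod_primes_dvd g₀ (fun p hp => (hC'p p hp).prime)
      fun p hp => Nat.dvd_of_mem_primeFactors (hCg (Finset.mem_sdiff.1 hp).1)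
    have hcop : r₀.Coprime P := Nat.Coprime.prod_right fun p hp => by
      have hpr : ¬ p ∣ r₀ := fun hd =>
        (Finset.mem_sdiff.1 hp).2 (Nat.mem_primeFactors.2 ⟨hC'p p hp, hd, hr0⟩)
      exact ((Nat.Prime.coprime_iff_not_dvd (hC'p p hp)).2 hpr).symm
    have hmg : m ∣ g₀ := Nat.Coprime.mul_dvd_of_dvd_of_dvd hcop hrg hPg
    have hmsub : m.primeFactors ⊆ g₀.primeFactors := Nat.primeFactors_mono hmg hg0
    rw [totient_eq_prod_sub_one hg₀sq, totient_eq_prod_sub_one hr₀sq,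
      ← Finset.prod_sdiff hsub, hb'eq _ (fun p hp => Nat.prime_of_mem_primeFactors
        (Finset.mem_sdiff.1 hp).1), ← hmsd, ← prod_sdiff_split hr₀m hmsub b, hb]
    rw [Finset.prod_div_distrib, Finset.prod_const]
    ring
  rw [Finset.sum_congr rfl hterm, ← Finset.mul_sum, ← Finset.mul_sum, hC', ← mul_assoc]
  have hφ : 0 ≤ ((Nat.totient r₀ : ℕ) : ℝ)⁻¹ := by positivity
  have hPC : 0 ≤ ∏ p ∈ C', b p := Finset.prod_nonneg fun p hp => by
    have := hbnn p; rw [if_pos (hC'p p hp)] at this; exact this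
  refine mul_le_mul_of_nonneg_left ?_ (mul_nonneg hφ hPC)
  -- Step 2: enlarge the range of summation and apply `sum_squarefree_ext_prod_le`
  have hFsub : F ⊆ (box₀ M R₀).filter (fun g₀ => Squarefree g₀ ∧ m ∣ g₀ ∧
      g₀.primeFactors ⊆ m.primeFactors ∪ S₁) := by
    intro g₀ hg₀
    obtain ⟨hg₀b, hrg, hCg, hpf⟩ := Finset.mem_filter.1 hg₀
    obtain ⟨⟨hg1, -⟩, hg₀sq, -⟩ := mem_box₀.1 hg₀b
    have hPg : P ∣ g₀ := Finset.prod_primes_dvd g₀ (fun p hp => (hC'p p hp).prime)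
      fun p hp => Nat.dvd_of_mem_primeFactors (hCg (Finset.mem_sdiff.1 hp).1)
    have hcop : r₀.Coprime P := Nat.Coprime.prod_right fun p hp => by
      have hpr : ¬ p ∣ r₀ := fun hd =>
        (Finset.mem_sdiff.1 hp).2 (Nat.mem_primeFactors.2 ⟨hC'p p hp, hd, hr0⟩)
      exact ((Nat.Prime.coprime_iff_not_dvd (hC'p p hp)).2 hpr).symm
    refine Finset.mem_filter.2 ⟨hg₀b, hg₀sq, Nat.Coprime.mul_dvd_of_dvd_of_dvd hcop hrg hPg, ?_⟩
    intro p hp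
    have hp' := hpf hp
    rw [hpfm]
    rcases Finset.mem_union.1 hp' with h1 | h1
    · rcases Finset.mem_union.1 h1 with h2 | h2
      · exact Finset.mem_union.2 (Or.inl (Finset.mem_union.2 (Or.inl h2)))
      · by_cases h3 : p ∈ r₀.primeFactors
        · exact Finset.mem_union.2 (Or.inl (Finset.mem_union.2 (Or.inl h3)))
        · exact Finset.mem_union.2 (Or.inl (Finset.mem_union.2 (Or.inr
            (Finset.mem_sdiff.2 ⟨h2, h3⟩))))
    · exact Finset.mem_union.2 (Or.inr h1)
  have hnn : ∀ g₀ ∈ (box₀ M R₀).filter (fun g₀ => Squarefree g₀ ∧ m ∣ g₀ ∧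
      g₀.primeFactors ⊆ m.primeFactors ∪ S₁), 0 ≤ ∏ p ∈ g₀.primeFactors \ m.primeFactors, b' p :=
    fun g₀ _ => Finset.prod_nonneg fun p _ => hbnn p
  refine (Finset.sum_le_sum_of_subset_of_nonneg hFsub fun g₀ hg₀ _ => hnn g₀ hg₀).trans ?_
  refine (sum_squarefree_ext_prod_le m S₁ (box₀ M R₀) b' hbnn).trans ?_
  refine Finset.prod_le_prod (fun p _ => by have := hbnn p; linarith) fun p hpS => ?_
  change 1 + (if p.Prime then b p else 0) ≤ 1 + 2 / ((p : ℝ) - 1)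
  rw [if_pos (hS₁ p hpS)]

/-! ### The bound for `y⁺` -/

/-- **The dual variables of the product weights are small** (P94-SPEC §1d′). Let `r⁺ ∈ box⁺`,
`a ≥ 0`, `A ≥ 0` with `|Y_g| ≤ A ∏_{p ∈ primes(∏ g) ∖ primes(∏ r)} a(p)` for all `g ∈ box` with
`r ∣ g`, and `N_i ≤ T` for all `i`. Then
`|dualY λ⁺ (r⁺)| ≤ A φ(r₀)^{-1} ∏_{p ∣ ∏ r} (1 + 2/(p-1)) ·
   ∏_{p ≤ T prime, p ∤ ∏ r} (1 + |κ| · 2 a(p) c(p))`, `c(p) = 1` if `p ∣ r₀`, else `2/(p-1)`.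
(The point: a fresh prime of `g` must also divide `g₀`, costing `2a(p) · 2/(p-1)` rather than `2a(p)`.)
[cite: Maynard2016DenseClusters, proof of Prop. 9.4 pp. 25–26 («y⁺_{(r,r₀)} ≪ y_r …»)] -/
theorem abs_dualY_lamProd_le {N₁ W₁ : κ → ℕ} {Y : (κ → ℕ) → ℝ} {M : ℕ} {R₀ : ℝ}
    {r : Option κ → ℕ} (hr : r ∈ gBox (optN N₁ R₀) (optW W₁ M)) {A : ℝ} (hA : 0 ≤ A)
    {a : ℕ → ℝ} (ha : ∀ p, 0 ≤ a p)
    (hY : ∀ g ∈ gBox N₁ W₁, (∀ i, r (some i) ∣ g i) →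
      |Y g| ≤ A * ∏ p ∈ (∏ j, g j).primeFactors \ (∏ j, r (some j)).primeFactors, a p)
    {T : ℕ} (hT : ∀ i, N₁ i ≤ T) :
    |dualY (optN N₁ R₀) (optW W₁ M) (lamProd N₁ W₁ Y M R₀) r| ≤
      A * ((Nat.totient (r none) : ℕ) : ℝ)⁻¹ *
        (∏ p ∈ (∏ j, r (some j)).primeFactors, (1 + 2 / ((p : ℝ) - 1))) *
        ∏ p ∈ ((Finset.range (T + 1)).filter Nat.Prime) \ (∏ j, r (some j)).primeFactors,
          (1 + Fintype.card κ * (2 * a p *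
            (if p ∈ (r none).primeFactors then 1 else 2 / ((p : ℝ) - 1)))) := by
  classical
  obtain ⟨hr₁, hr₀, -⟩ := mem_gBox_opt.1 hr
  obtain ⟨⟨hr01, -⟩, hr₀sq, -⟩ := mem_box₀.1 hr₀
  have hr00 : r none ≠ 0 := by omega
  -- notation
  set box := gBox N₁ W₁ with hbox
  set bx0 := box₀ M R₀ with hbx0
  set S₁ := (∏ j, r (some j)).primeFactors with hS₁
  have hS₁p : ∀ p ∈ S₁, p.Prime := fun p hp => Nat.prime_of_mem_primeFactors hp
  set Cf : (κ → ℕ) → Finset ℕ := fun g => (∏ j, g j).primeFactors \ S₁ with hCf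
  have hCfp : ∀ g, ∀ p ∈ Cf g, p.Prime := fun g p hp =>
    Nat.prime_of_mem_primeFactors (Finset.mem_sdiff.1 hp).1
  set b' : ℕ → ℝ := fun p => if p.Prime then 2 / ((p : ℝ) - 1) else 0 with hb'
  have hb'nn : ∀ p, 0 ≤ b' p := by
    intro p
    change 0 ≤ (if p.Prime then 2 / ((p : ℝ) - 1) else 0)
    split_ifs with hp
    · have : (2 : ℝ) ≤ p := by exact_mod_cast hp.two_le
      exact div_nonneg (by norm_num) (by linarith)
    · exact le_rfl
  have hb'eq : ∀ {p : ℕ}, p.Prime → b' p = 2 / ((p : ℝ) - 1) := fun hp => if_pos hp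
  set c : ℕ → ℝ := fun p => if p ∈ (r none).primeFactors then 1 else b' p with hc
  have hcnn : ∀ p, 0 ≤ c p := by
    intro p
    change 0 ≤ (if p ∈ (r none).primeFactors then (1 : ℝ) else b' p)
    split_ifs
    · exact zero_le_one
    · exact hb'nn p
  set w : ℕ → ℝ := fun p => 2 * a p * c p with hw
  have hwnn : ∀ p, 0 ≤ w p := fun p => mul_nonneg (mul_nonneg (by norm_num) (ha p)) (hcnn p)
  set P₁ := ∏ p ∈ S₁, (1 + 2 / ((p : ℝ) - 1)) with hP₁
  have hP₁nn : 0 ≤ P₁ := Finset.prod_nonneg fun p hp => by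
    have : (2 : ℝ) ≤ p := by exact_mod_cast (hS₁p p hp).two_le
    have : (0 : ℝ) ≤ 2 / ((p : ℝ) - 1) := div_nonneg (by norm_num) (by linarith)
    linarith
  set φ₀ := ((Nat.totient (r none) : ℕ) : ℝ)⁻¹ with hφ₀
  have hφ₀nn : 0 ≤ φ₀ := by positivity
  -- the summation predicates
  set Q : (κ → ℕ) → ℕ → Prop := fun g g₀ => r none ∣ g₀ ∧ Cf g ⊆ g₀.primeFactors ∧
      g₀.primeFactors ⊆ (r none).primeFactors ∪ Cf g ∪ S₁ with hQ
  -- Step 1: triangle inequality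
  rw [dualY_lamProd_eq]
  have hμ : |((μ (∏ o, r o) : ℤ) : ℝ)| ≤ 1 := by exact_mod_cast ArithmeticFunction.abs_moebius_le_one
  set t : (κ → ℕ) → ℕ → ℝ := fun g g₀ =>
    |Y g| * ((Nat.totient g₀ : ℕ) : ℝ)⁻¹ * |couplingB N₁ W₁ r g g₀| with ht
  have htnn : ∀ g g₀, 0 ≤ t g g₀ := fun g g₀ =>
    mul_nonneg (mul_nonneg (abs_nonneg _) (by positivity)) (abs_nonneg _)
  have h1 : |((μ (∏ o, r o) : ℤ) : ℝ) * ∑ g ∈ box, ∑ g₀ ∈ bx0,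
      Y g * ((Nat.totient g₀ : ℕ) : ℝ)⁻¹ * couplingB N₁ W₁ r g g₀| ≤
      ∑ g ∈ box, ∑ g₀ ∈ bx0, t g g₀ := by
    rw [abs_mul]
    refine (mul_le_of_le_one_left (abs_nonneg _) hμ).trans ?_
    refine (Finset.abs_sum_le_sum_abs _ _).trans (Finset.sum_le_sum fun g _ => ?_)
    refine (Finset.abs_sum_le_sum_abs _ _).trans (Finset.sum_le_sum fun g₀ _ => ?_)
    rw [abs_mul, abs_mul, abs_of_nonneg (by positivity : (0 : ℝ) ≤ ((Nat.totient g₀ : ℕ) : ℝ)⁻¹)]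
  refine h1.trans ?_
  -- Step 2: restrict the ranges of summation (the other terms vanish)
  have hvan : ∀ g ∈ box, ∀ g₀ ∈ bx0, t g g₀ ≠ 0 → (∀ i, r (some i) ∣ g i) ∧ Q g g₀ := by
    intro g hg g₀ hg₀ hne
    obtain ⟨⟨hg01, -⟩, hg₀sq, -⟩ := mem_box₀.1 hg₀
    have hB : couplingB N₁ W₁ r g g₀ ≠ 0 := fun h0 => hne (by rw [ht]; simp [h0])
    have hdv : (∀ i, r (some i) ∣ g i) ∧ r none ∣ g₀ := by
      by_contra hcon
      exact hB (couplingB_eq_zero_of_not_dvd N₁ W₁ r g g₀ hcon)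
    have hC1 : Cf g ⊆ g₀.primeFactors := by
      by_contra hcon
      exact hB (couplingB_eq_zero_of_not_subset_left hg hdv.1 hg₀sq.ne_zero hcon)
    have hC2 : g₀.primeFactors \ (r none).primeFactors ⊆ (∏ j, g j).primeFactors := by
      by_contra hcon
      exact hB (couplingB_eq_zero_of_not_subset_right hg hg₀sq hdv.2 hcon)
    refine ⟨hdv.1, hdv.2, hC1, fun p hp => ?_⟩
    by_cases hpr : p ∈ (r none).primeFactors
    · exact Finset.mem_union.2 (Or.inl (Finset.mem_union.2 (Or.inl hpr)))
    · have hpg : p ∈ (∏ j, g j).primeFactors := hC2 (Finset.mem_sdiff.2 ⟨hp, hpr⟩)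
      by_cases hpS : p ∈ S₁
      · exact Finset.mem_union.2 (Or.inr hpS)
      · exact Finset.mem_union.2 (Or.inl (Finset.mem_union.2 (Or.inr
          (Finset.mem_sdiff.2 ⟨hpg, hpS⟩))))
  have h2 : ∑ g ∈ box, ∑ g₀ ∈ bx0, t g g₀ =
      ∑ g ∈ box.filter (fun g => ∀ i, r (some i) ∣ g i), ∑ g₀ ∈ bx0.filter (Q g), t g g₀ := by
    rw [← Finset.sum_filter_of_ne (p := fun g => ∀ i, r (some i) ∣ g i) (fun g hg hne => ?_)]
    · refine Finset.sum_congr rfl fun g hg => ?_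
      obtain ⟨hgb, -⟩ := Finset.mem_filter.1 hg
      rw [← Finset.sum_filter_of_ne (p := Q g) (fun g₀ hg₀ hne => (hvan g hgb g₀ hg₀ hne).2)]
    · obtain ⟨g₀, hg₀, hne0⟩ := Finset.exists_ne_zero_of_sum_ne_zero hne
      exact (hvan g hg g₀ hg₀ hne0).1
  rw [h2]
  -- Step 3: termwise bound on the restricted ranges, then the g₀-sum
  have h3 : ∀ g ∈ box.filter (fun g => ∀ i, r (some i) ∣ g i),
      ∑ g₀ ∈ bx0.filter (Q g), t g g₀ ≤
        (A * ∏ p ∈ Cf g, w p) * (φ₀ * P₁) := by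
    intro g hg
    obtain ⟨hgb, hrg⟩ := Finset.mem_filter.1 hg
    have hAg : 0 ≤ A * ∏ p ∈ Cf g, a p := mul_nonneg hA (Finset.prod_nonneg fun p _ => ha p)
    -- termwise
    have hle : ∀ g₀ ∈ bx0.filter (Q g), t g g₀ ≤
        (A * (∏ p ∈ Cf g, a p) * (2 : ℝ) ^ (Cf g).card) *
          (((Nat.totient g₀ : ℕ) : ℝ)⁻¹ * (2 : ℝ) ^ (g₀.primeFactors \ (r none).primeFactors).card) := by
      intro g₀ hg₀
      obtain ⟨hg₀b, -⟩ := Finset.mem_filter.1 hg₀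
      obtain ⟨-, hg₀sq, -⟩ := mem_box₀.1 hg₀b
      have hB := abs_couplingB_le_two_pow r hgb hg₀sq
      have hYg := hY g hgb hrg
      have hφ : 0 ≤ ((Nat.totient g₀ : ℕ) : ℝ)⁻¹ := by positivity
      calc t g g₀ = (|Y g| * |couplingB N₁ W₁ r g g₀|) * ((Nat.totient g₀ : ℕ) : ℝ)⁻¹ := by
              rw [ht]; ring
        _ ≤ ((A * ∏ p ∈ Cf g, a p) * ((2 : ℝ) ^ (Cf g).card *
              (2 : ℝ) ^ (g₀.primeFactors \ (r none).primeFactors).card)) *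
              ((Nat.totient g₀ : ℕ) : ℝ)⁻¹ := by
              refine mul_le_mul_of_nonneg_right ?_ hφ
              exact mul_le_mul hYg hB (abs_nonneg _) hAg
        _ = _ := by ring
    refine (Finset.sum_le_sum hle).trans ?_
    rw [← Finset.mul_sum]
    have hg0 := sum_g0_le (M := M) (R₀ := R₀) hr₀ (Cf g) S₁ (hCfp g) hS₁p
    have hcoef : 0 ≤ A * (∏ p ∈ Cf g, a p) * (2 : ℝ) ^ (Cf g).card := mul_nonneg hAg (by positivity)
    refine (mul_le_mul_of_nonneg_left hg0 hcoef).trans (le_of_eq ?_)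
    -- the identity `(∏ a) 2^{#C} ∏_{C ∖ primes r₀} (2/(p-1)) = ∏ w`
    have hprodw : ∏ p ∈ Cf g, w p =
        (∏ p ∈ Cf g, a p) * (2 : ℝ) ^ (Cf g).card *
          ∏ p ∈ Cf g \ (r none).primeFactors, 2 / ((p : ℝ) - 1) := by
      rw [hw, Finset.prod_mul_distrib, Finset.prod_mul_distrib, Finset.prod_const]
      have hcprod : ∏ p ∈ Cf g, c p = ∏ p ∈ Cf g \ (r none).primeFactors, 2 / ((p : ℝ) - 1) := by
        rw [hc, Finset.prod_ite, Finset.prod_const_one, one_mul, Finset.sdiff_eq_filter]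
        refine Finset.prod_congr rfl fun p hp => ?_
        exact hb'eq (hCfp g p (Finset.mem_filter.1 hp).1)
      rw [hcprod]
      ring
    rw [hprodw]
    ring
  refine (Finset.sum_le_sum h3).trans ?_
  -- Step 4: the g-sum via `sum_ext_prod_le`
  set S := ((Finset.range (T + 1)).filter Nat.Prime) \ S₁ with hS
  have hSp : ∀ p ∈ S, p.Prime := fun p hp => (Finset.mem_filter.1 (Finset.mem_sdiff.1 hp).1).2
  have hSdisj : Disjoint S S₁ := Finset.sdiff_disjoint
  have hsub : box.filter (fun g => ∀ i, r (some i) ∣ g i) ⊆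
      box.filter (fun g => (∀ i, r (some i) ∣ g i) ∧ (∏ j, g j).primeFactors ⊆ S₁ ∪ S) := by
    intro g hg
    obtain ⟨hgb, hrg⟩ := Finset.mem_filter.1 hg
    refine Finset.mem_filter.2 ⟨hgb, hrg, fun p hp => ?_⟩
    by_cases hpS : p ∈ S₁
    · exact Finset.mem_union.2 (Or.inl hpS)
    · refine Finset.mem_union.2 (Or.inr (Finset.mem_sdiff.2 ⟨?_, hpS⟩))
      have hpP : p.Prime := Nat.prime_of_mem_primeFactors hp
      obtain ⟨j, -, hpj⟩ := (hpP.prime.dvd_finsetProd_iff _).1 (Nat.dvd_of_mem_primeFactors hp)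
      have hle : p ≤ T := (Nat.le_of_dvd (one_le_of_mem_gBox hgb j) hpj).trans
        ((le_of_mem_gBox hgb j).trans (hT j))
      exact Finset.mem_filter.2 ⟨Finset.mem_range.2 (by omega), hpP⟩
  have hnn : ∀ g ∈ box.filter (fun g => (∀ i, r (some i) ∣ g i) ∧
      (∏ j, g j).primeFactors ⊆ S₁ ∪ S), 0 ≤ ∏ p ∈ Cf g, w p :=
    fun g _ => Finset.prod_nonneg fun p _ => hwnn p
  have h4 : ∑ g ∈ box.filter (fun g => ∀ i, r (some i) ∣ g i), ∏ p ∈ Cf g, w p ≤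
      ∏ p ∈ S, (1 + Fintype.card κ * w p) :=
    (Finset.sum_le_sum_of_subset_of_nonneg hsub fun g hg _ => hnn g hg).trans
      (sum_ext_prod_le N₁ W₁ hr₁ w hwnn S hSp hSdisj)
  have hcoef : 0 ≤ A * (φ₀ * P₁) := mul_nonneg hA (mul_nonneg hφ₀nn hP₁nn)
  have h5 : ∏ p ∈ S, (1 + Fintype.card κ * w p) =
      ∏ p ∈ S, (1 + Fintype.card κ * (2 * a p *
        (if p ∈ (r none).primeFactors then 1 else 2 / ((p : ℝ) - 1)))) := by
    refine Finset.prod_congr rfl fun p hp => ?_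
    have hcp : c p = (if p ∈ (r none).primeFactors then 1 else 2 / ((p : ℝ) - 1)) := by
      change (if p ∈ (r none).primeFactors then (1 : ℝ) else b' p) = _
      split_ifs with h
      · rfl
      · exact hb'eq (hSp p hp)
    rw [hw]
    simp only [hcp]
  calc ∑ g ∈ box.filter (fun g => ∀ i, r (some i) ∣ g i), (A * ∏ p ∈ Cf g, w p) * (φ₀ * P₁)
      = A * (φ₀ * P₁) * ∑ g ∈ box.filter (fun g => ∀ i, r (some i) ∣ g i), ∏ p ∈ Cf g, w p := by
        rw [Finset.mul_sum]
        exact Finset.sum_congr rfl fun g _ => by ring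
    _ ≤ A * (φ₀ * P₁) * ∏ p ∈ S, (1 + Fintype.card κ * w p) :=
        mul_le_mul_of_nonneg_left h4 hcoef
    _ = A * φ₀ * P₁ * ∏ p ∈ S, (1 + Fintype.card κ * (2 * a p *
        (if p ∈ (r none).primeFactors then 1 else 2 / ((p : ℝ) - 1)))) := by
        rw [h5]; ring

end Literature.NumberTheory.Sieve.SelbergBox
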